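import Summits.AtomisticToContinuum.FouriersLaw.Theses.PhononMeanFreePath
import Summits.AtomisticToContinuum.FouriersLaw.Theorems.BoundaryKubo.Negative.LoadBearing
import Literature.MathematicalPhysics.KineticTheory.LangevinSemigroupProofs
import Literature.MathematicalPhysics.KineticTheory.LangevinChainGibbs

/-!
# Line `poisson-transfer` for crux `PhononMeanFreePath.BoundaryKubo` (stmt-AtomisticToContinuum-11812)

Crux-plan seat `planner-cruxplan-stmt-AtomisticToContinuum-11812-poisson-transfer-0`, 2026-08-16.
Line card: `Lines/poisson-transfer.md` (same directory). Idea card: `Ideas/poisson-transfer.md`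
(triage r1: pass ×3).

## The line in one paragraph

Chain of `N+1` sites, `P = pinnedChain ω₂ lam β γ`, `μ_δ := μ (N+1) (T+δ/2) (T-δ/2)` the member of the
steady family, `μ₀ = P.gibbsMeasure (N+1) T`, `K_t = P.transitionKernel (N+1) T T t`. NEVER differentiate
in `δ`: (1) ENERGY BALANCE at the right bath, `totalCurrent μ_δ = N·γ·(μ_δ(p_N²) - (T - δ/2))`
(`stub_energyBalance`); (2) the generator is AFFINE in the bath temperatures (PROVED here:
`generator_affine`), so testing the stationarity of `μ_δ` (`stub_extendedStationarity`, Dynkin beyond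
`C_c^∞`) against the EQUILIBRIUM Poisson solution `F = ∫₀^∞ (K_t p_N² - T) dt`, `L_{T,T} F = -(p_N² - T)`
(`stub_poissonSolution`, the HARDEST stub: weighted `C²` bounds) gives the exact finite-`δ` identity
`μ_δ(p_N²) - T = (γδ/2)·μ_δ(W)`, `W = ∂²_{p_0}F - ∂²_{p_N}F`; hence `totalCurrent μ_δ / δ = Nγ((γ/2)μ_δ(W) + 1/2)`
EXACTLY on `0 < |δ| < δ₁`; (3) `δ ↦ μ_δ(W)` is CONTINUOUS at `0` with limit `μ₀(W)` (`stub_nessContinuity`: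
tightness from locally uniform exponential moments `stub_uniformExpMoments` = the panel's `LocallyUniformH2`,
plus the crux's own uniqueness hypothesis at `(T,T)`); (4) the value: Gaussian integration by parts under
the explicit Gibbs density, `T²μ₀(∂²_{p_0}F) = μ₀((p_0²-T)F)`, and the bath SUM RULE `γ μ₀(∂²_{p_0}F + ∂²_{p_N}F) = 1`
(`stub_gibbsPairing`; the sum rule is the response to a UNIFORM temperature shift, along which the steady
state is the explicit Gibbs family — no detailed balance needed), and the Green–Kubo pairing
`μ₀((p_0²-T)F) = ∫₀^∞ C_N` (`stub_greenKuboPairing`, Fubini + Harris decay (2.5) at equal temperatures,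
which also yields `C_N ∈ L¹`). Algebra: `Nγ((γ/2)(A-B) + 1/2) = Nγ²A = N(γ²/T²)∫₀^∞C_N` — the crux's value,
constant included (refuter-calibrated `N·γ²/T²`).

## Shape (audited by `ledger skeleton check … --crux stmt-AtomisticToContinuum-11812`)

* seven registered stubs `stub_*` (sorried, statements inlined over existing declarations only);
* PROVED glue: `generator_sub_generator`, `generator_affine` (affine dependence on `(T_L, T_R)`),
  `family_spec` (under weak-NESS uniqueness the steady family IS the Harris invariant probability measure of
  the constructed kernels: probability, kernel-invariant, all exponential moments `ϑ < 1/max(T_L,T_R)` —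
  tree: `pinnedChainSemigroup_ergodic`, `pinnedChain_isSteadyState_of_isInvariant`), and the composition
  `boundaryKubo_of_stubs` (≈ 150 lines of limits-and-integrals bookkeeping, no `sorry`);
* `BoundaryKubo_of : BoundaryKubo` — concludes the crux BY NAME (`boundaryKubo_iff` is `Iff.rfl`).

Disproof.lean (cdisprove cycle 1) honoured: `limitClause_false_without_steady` — the family enters only through
`family_spec` (stationarity ⇒ invariance-class identification) feeding stubs 1, 4, 6; `_false_without_T_pos` —
`T > 0` enters through `family_spec`/`steadyFamily_apply_self`; §5 (`γ > 0` only via mixing/uniqueness) — the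
algebra (`generator_affine`) holds for every `γ`; §6 reflection NOT needed (symmetric protocol handled by
`W = ∂²_{p_0}F - ∂²_{p_N}F` and the sum rule); §7 — no pointwise positivity of `C_N` used; `N = 0` consistent
(`W ≡ 0`, `totalCurrent ≡ 0`, value `0`).
-/

noncomputable section

namespace Summit.AtomisticToContinuum.FouriersLaw.Cruxes.BoundaryKubo.PoissonTransfer

open MeasureTheory ProbabilityTheory Filter Topology Set
open Literature.MathematicalPhysics.KineticTheory.HeatConduction
open Summit.AtomisticToContinuum.FouriersLaw.Theses.PhononMeanFreePath (BoundaryKubo)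
open Summit.AtomisticToContinuum.FouriersLaw.Theorems.BoundaryKubo.Negative.LoadBearing
  (kuboIntegrand kuboValue LimitClause UniqueSteady SteadyFamily boundaryKubo_iff steadyFamily_apply_self)

/-! ## § 0 Proved glue: the generator is affine in the bath temperatures -/

/-- The Langevin generator depends AFFINELY on the bath temperatures: only the two diffusion terms
`γ T_L ∂²_{p_0}`, `γ T_R ∂²_{p_{M-1}}` carry them, with NO remainder. [folklore] -/
theorem generator_sub_generator (P : OscillatorChain) (M : ℕ) (a b a' b' : ℝ)
    (f : PhaseSpace M → ℝ) (x : PhaseSpace M) :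
    P.generator M a b f x - P.generator M a' b' f x =
      P.γ * ∑ i : Fin M, ((if i.val = 0 then (a - a') * partialP i (partialP i f) x else 0) +
        (if i.val = M - 1 then (b - b') * partialP i (partialP i f) x else 0)) := by
  unfold OscillatorChain.generator
  rw [add_sub_add_left_eq_sub, ← mul_sub, ← Finset.sum_sub_distrib]
  congr 1
  refine Finset.sum_congr rfl fun i _ => ?_
  split_ifs <;> ring

/-- `∑_{i} [i = 0] g i = g 0` on `Fin (N+1)`. [folklore] -/
theorem sum_ite_val_eq_zero {N : ℕ} (g : Fin (N + 1) → ℝ) :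
    ∑ i : Fin (N + 1), (if i.val = 0 then g i else 0) = g 0 := by
  rw [Finset.sum_eq_single (0 : Fin (N + 1))]
  · simp
  · intro b _ hb
    rw [if_neg]
    exact fun h => hb (Fin.ext h)
  · exact fun h => absurd (Finset.mem_univ _) h

/-- `∑_{i} [i = N] g i = g (last N)` on `Fin (N+1)`. [folklore] -/
theorem sum_ite_val_eq_last {N : ℕ} (g : Fin (N + 1) → ℝ) :
    ∑ i : Fin (N + 1), (if i.val = N + 1 - 1 then g i else 0) = g (Fin.last N) := by
  rw [Finset.sum_eq_single (Fin.last N)]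
  · simp
  · intro b _ hb
    rw [if_neg]
    intro h
    exact hb (Fin.ext (by rw [Fin.val_last]; omega))
  · exact fun h => absurd (Finset.mem_univ _) h

/-- **Affine dependence, chain of `N+1` sites `0..N`**: for any reference temperature `T`,
`L_{a,b} f = L_{T,T} f + γ((a-T) ∂²_{p_0} f + (b-T) ∂²_{p_N} f)` pointwise (also for `N = 0`, where both
baths sit on site `0`). This is the identity `L_δ = L₀ + δ·V`, `V = (γ/2)(∂²_{p_0} - ∂²_{p_N})`, of the
idea card (`generatorAffine`, ideator 1). [folklore] -/
theorem generator_affine (P : OscillatorChain) (N : ℕ) (a b T : ℝ) (f : PhaseSpace (N + 1) → ℝ)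
    (x : PhaseSpace (N + 1)) :
    P.generator (N + 1) a b f x = P.generator (N + 1) T T f x +
      P.γ * ((a - T) * partialP 0 (partialP 0 f) x +
        (b - T) * partialP (Fin.last N) (partialP (Fin.last N) f) x) := by
  have h := generator_sub_generator P (N + 1) a b T T f x
  rw [Finset.sum_add_distrib, sum_ite_val_eq_zero, sum_ite_val_eq_last] at h
  linarith

/-! ## § 1 Proved glue: under weak-NESS uniqueness the steady family is the Harris invariant measure -/

/-- **Identification of the family.** Under `UniqueSteady` (the crux's hypothesis = item `NessUnique` at the
parameter point), the member `μ (N+1) a b` (`a, b > 0`) of a steady family IS the unique invariant probability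
measure of the constructed transition semigroup (`pinnedChainSemigroup_ergodic`: it exists, is a weak steady
state by `pinnedChain_isSteadyState_of_isInvariant`, hence equals `μ (N+1) a b`): so `μ (N+1) a b` is a
probability measure, invariant under every kernel `transitionKernel (N+1) a b t`, and integrates `e^{ϑH}` for
all `0 < ϑ < 1/max(a,b)`. This is where the crux's hypothesis `H = uniqueness` is consumed (Disproof §4). [folklore] -/
theorem family_spec {ω₂ lam β γ : ℝ} (hω : 0 < ω₂) (hl : 0 < lam) (hβ : 0 < β) (hγ : 0 < γ)
    (hU : UniqueSteady ω₂ lam β γ) {μ : (M : ℕ) → ℝ → ℝ → Measure (PhaseSpace M)}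
    (hμ : SteadyFamily ω₂ lam β γ μ) (N : ℕ) {a b : ℝ} (ha : 0 < a) (hb : 0 < b) :
    IsProbabilityMeasure (μ (N + 1) a b) ∧
      (∀ t, Kernel.Invariant ((pinnedChain ω₂ lam β γ).transitionKernel (N + 1) a b t)
        (μ (N + 1) a b)) ∧
      ∀ ϑ : ℝ, 0 < ϑ → ϑ < 1 / max a b →
        Integrable (fun x => Real.exp (ϑ * (pinnedChain ω₂ lam β γ).hamiltonian (N + 1) x))
          (μ (N + 1) a b) := by
  obtain ⟨-, μs, hμs, hinv, hrest⟩ :=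
    pinnedChainSemigroup_ergodic hω hl.le hβ hγ (Nat.succ_pos N) ha hb
  have hm : 0 < max a b := lt_max_of_lt_left ha
  have hϑ0 : 0 < 1 / max a b / 2 := by positivity
  have hϑ1 : 1 / max a b / 2 < 1 / max a b := half_lt_self (by positivity)
  have hst : (pinnedChain ω₂ lam β γ).IsSteadyState (N + 1) a b μs :=
    pinnedChain_isSteadyState_of_isInvariant hω.le hl.le hβ.le γ (N + 1) _ hinv hϑ0
      (hrest _ hϑ0 hϑ1).1
  have heq : μ (N + 1) a b = μs := hU (N + 1) a b ha hb _ _ (hμ (N + 1) a b ha hb) hst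
  rw [heq]
  exact ⟨hμs, fun t => hinv t, fun ϑ h0 h1 => (hrest ϑ h0 h1).1⟩


/-! ## § 2 The seven registered stubs (statements inlined over existing declarations only)

Conventions in all stubs: chain of `N+1` sites (`PhaseSpace (N + 1)`, right bath on `Fin.last N`);
`(pinnedChain ω₂ lam β γ).transitionKernel (N + 1) a b t` are the CONSTRUCTED Langevin kernels
(`LangevinChainKernel.lean`); "`ν` invariant" = `Kernel.Invariant` for every `t`; weights `e^{ϑH}`. -/

/-- **stub 1 — `stub_energyBalance` (ENERGY BALANCE AT THE RIGHT BATH; size M).**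
For every probability measure `ν` on the `(N+1)`-site phase space which is invariant under the constructed
kernels at bath temperatures `(a, b)` and integrates `e^{ϑH}` for all `0 < ϑ < 1/max(a,b)` (= the Harris
invariant measure, by `pinnedChainSemigroup_ergodic`): `p_N² ∈ L¹(ν)` and
`totalCurrent ν = N · γ · (ν(p_N²) - b)` — every mean bond current equals the power `γ(ν(p_N²) - T_R)`
absorbed by the right bath.
Why true: stationarity extends from `C_c^∞` to polynomially bounded smooth observables (Dynkin for
`f·χ_R(H)` + invariance + dominated convergence with the exponential moments); applied to the tail energies
`H_{≥k} = Σ_{i≥k}(p_i²/2 + U(q_i)) + Σ_{i≥k} V(q_{i+1}-q_i)`, `L_{a,b} H_{≥k} = -p_k V'(q_k - q_{k-1}) + γ(b - p_N²)`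
(`k ≥ 1`), and to the bond energies `V(q_k - q_{k-1})` (`ν(p_k V') = ν(½(p_{k-1}+p_k)V')`), giving
`ν(j_{k-1}) = γ(ν(p_N²) - b)` for each of the `N` bonds; `j_N ≡ 0` (no bond leaves the last site).
`N = 0`: both sides vanish. Checked exactly in the Gaussian closure by all three triagers (C4/A2/ep_check).
Why it might fail: only a sign/normalisation slip (tree convention `j_i = -½(p_i+p_{i+1})V'(q_{i+1}-q_i)`).
Sources: BonettoLebowitzReyBellet2000 §5.2 (24)–(27); KunduDharNarayan2009 (J_fp); TRIAGE-r1-1 C4, r1-2 A2, r1-3. -/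
theorem stub_energyBalance :
    ∀ ω₂ lam β γ : ℝ, 0 < ω₂ → 0 < lam → 0 < β → 0 < γ →
    ∀ (N : ℕ) (a b : ℝ), 0 < a → 0 < b →
    ∀ ν : Measure (PhaseSpace (N + 1)), IsProbabilityMeasure ν →
      (∀ t, ProbabilityTheory.Kernel.Invariant
        ((pinnedChain ω₂ lam β γ).transitionKernel (N + 1) a b t) ν) →
      (∀ ϑ : ℝ, 0 < ϑ → ϑ < 1 / max a b →
        Integrable (fun x => Real.exp (ϑ * (pinnedChain ω₂ lam β γ).hamiltonian (N + 1) x)) ν) →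
      Integrable (fun x : PhaseSpace (N + 1) => (x.2 (Fin.last N)) ^ 2) ν ∧
        (pinnedChain ω₂ lam β γ).totalCurrent ν =
          N * γ * ((∫ x, (x.2 (Fin.last N)) ^ 2 ∂ν) - b) := by
  sorry

/-- **stub 2 — `stub_poissonSolution` (THE EQUILIBRIUM POISSON SOLUTION, WEIGHTED `C²`; HARDEST, size L).**
At equal temperatures `(T,T)`, assuming the Gibbs state is invariant under the constructed kernels (free under
the crux's uniqueness hypothesis, `family_spec`), the function `F(x) = ∫₀^∞ (K_t p_N²(x) - T) dt` is well
defined (the integrand is integrable on `(0,∞)` by Harris (2.5), `pinnedChainSemigroup_exp_convergence`, since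
`μ₀(p_N²) = T`), is `C²`, satisfies the weighted bounds `|F|, |∂_{q_i}F|, |∂_{p_i}F|, |∂²_{p_i}F| ≤ C e^{ϑH}`
for SOME `0 < ϑ < 1/T`, and solves the Poisson equation `L_{T,T} F = -(p_N² - T)` pointwise.
Why true / engines: `|F| ≤ (C/c)e^{ϑ₀H}` for every `ϑ₀ > 0` directly from (2.5); `F` is a continuous
distributional solution (finite-time Dynkin + decay), hence smooth by hypoellipticity of `L_{T,T}` (Hörmander,
PROVED in tree: `hormander1967_thm11_proof`, bracket condition as in `LangevinChainHormander`); the WEIGHTED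
DERIVATIVE BOUNDS are the open part: (a) interior hypoelliptic (Kohn/Rothschild–Stein) estimates on unit boxes
with polynomial dependence on the local size of the coefficients `p`, `∂_qH` (the bracket span is UNIFORM:
`V'' ≥ 1`, CEHR C2) + `sup_{B(x,2)} e^{ϑ₀H} ≤ C_ε e^{(ϑ₀+ε)H(x)}`; or (b) time-one smoothing `D²(K_1 h)` in
weighted sup norms via Bismut–Elworthy–Li / partial Malliavin calculus for the two noisy momenta with
finite-time tangent-flow moments (`‖DY‖ ≲ 1+√H`, card sublinear-hessian; inverse Gramian moments tested by
kit j009533 / j009657: `λ_min(M₁)` bounded below and INCREASING with energy), then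
`D²F = Σ_n D²K_1(K_n ḡ) + D²∫₀¹K_t ḡ`, `‖K_n ḡ‖_{ϑ₀} ≲ e^{-cn}`.
Why it might fail: derivative loss in the weight scale could be worse than `e^{εH}` (e.g. `e^{c√H}` is fine,
`e^{cH}` with `c ≥ 1/T - ϑ₀` kills this stub and forces the `C¹`/`L²` downgrade of cards
fisher-budget / entropy-production-fisher-pairing — reshape `stub_extendedStationarity`+`stub_gibbsPairing`
to one `p`-derivative).
Sources: HairerMajda2010 (arXiv:0909.4313) §4 (Ass. 4–5, Prop. 4.5–4.7); CuneoEckmannHairerReyBellet2018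
Thm 2.13/(2.5), Prop. 4.1; PardouxVeretennikov2001 (Poisson equation, elliptic model); card poisson-transfer
"HARDEST UNPROVED INGREDIENT"; TRIAGE-r1-3 sharpening `EquilibriumPoissonC2`. -/
theorem stub_poissonSolution :
    ∀ ω₂ lam β γ : ℝ, 0 < ω₂ → 0 < lam → 0 < β → 0 < γ → ∀ (N : ℕ) (T : ℝ), 0 < T →
      (∀ t, ProbabilityTheory.Kernel.Invariant
        ((pinnedChain ω₂ lam β γ).transitionKernel (N + 1) T T t)
        ((pinnedChain ω₂ lam β γ).gibbsMeasure (N + 1) T)) →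
      ∃ (F : PhaseSpace (N + 1) → ℝ) (ϑ C : ℝ), 0 < ϑ ∧ ϑ < 1 / T ∧ ContDiff ℝ 2 F ∧
        (∀ x, |F x| ≤ C * Real.exp (ϑ * (pinnedChain ω₂ lam β γ).hamiltonian (N + 1) x)) ∧
        (∀ i x, |partialQ i F x| ≤
          C * Real.exp (ϑ * (pinnedChain ω₂ lam β γ).hamiltonian (N + 1) x)) ∧
        (∀ i x, |partialP i F x| ≤
          C * Real.exp (ϑ * (pinnedChain ω₂ lam β γ).hamiltonian (N + 1) x)) ∧
        (∀ i x, |partialP i (partialP i F) x| ≤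
          C * Real.exp (ϑ * (pinnedChain ω₂ lam β γ).hamiltonian (N + 1) x)) ∧
        (∀ x, (pinnedChain ω₂ lam β γ).generator (N + 1) T T F x =
          -((x.2 (Fin.last N)) ^ 2 - T)) ∧
        (∀ x, IntegrableOn (fun t : ℝ => (∫ y, (y.2 (Fin.last N)) ^ 2
              ∂((pinnedChain ω₂ lam β γ).transitionKernel (N + 1) T T t.toNNReal x)) - T)
            (Set.Ioi 0) ∧
          F x = ∫ t in Set.Ioi (0 : ℝ), ((∫ y, (y.2 (Fin.last N)) ^ 2
              ∂((pinnedChain ω₂ lam β γ).transitionKernel (N + 1) T T t.toNNReal x)) - T)) := by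
  sorry

/-- **stub 3 — `stub_greenKuboPairing` (GREEN–KUBO INTEGRAL = STATIC PAIRING WITH THE POISSON SOLUTION;
size M).** At `(T,T)` with the Gibbs state kernel-invariant: for every continuous `F = O(e^{ϑH})`
(`ϑ < 1/T`) represented as `F(x) = ∫₀^∞ (K_t p_N²(x) - T) dt`, the crux's integrand
`C_N(t) = Cov_{μ₀}(p_0², K_t p_N²)` (`kuboIntegrand`, landed `Negative/LoadBearing`) is integrable on
`(0,∞)` and `∫ (p_0² - T) F dμ₀ = ∫₀^∞ C_N(t) dt`. This is exactly BLR's passage (35) ↔ (32)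
("`D = μ₀(Φ_R L₀⁻¹ Φ_R)`" vs the time-integral Kubo form), the printed gap of §6.3, closed at fixed `N` by the
Harris decay now in the tree.
Why true: `C_N(t) = ∫ (p_0² - μ₀(p_0²))(K_t p_N² - T) dμ₀` (constants drop out of a covariance),
`|K_t p_N²(x) - T| ≤ C_ϑ e^{ϑH(x)} e^{-ct}` ((2.5) at `(T,T)`, `μ⋆ = μ₀` by invariance + uniqueness of the
invariant probability measure, `pinnedChainSemigroup_ergodic`), joint measurability from
`pinnedChain_measurable_transitionKernel`, then Fubini on `μ₀ ⊗ Leb(0,∞)` and `μ₀(p_0²) = T` (equipartition).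
Why it might fail: bookkeeping only (measurability in `t`; `t.toNNReal` junk at `t ≤ 0` is outside `Ioi 0`).
Sources: BonettoLebowitzReyBellet2000 §5.2 (32), §6.3 (34)–(36); CuneoEckmannHairerReyBellet2018 (2.5);
card poisson-transfer (closing); Disproof §0 (`kuboIntegrand` read-back). -/
theorem stub_greenKuboPairing :
    ∀ ω₂ lam β γ : ℝ, 0 < ω₂ → 0 < lam → 0 < β → 0 < γ → ∀ (N : ℕ) (T : ℝ), 0 < T →
      (∀ t, ProbabilityTheory.Kernel.Invariant
        ((pinnedChain ω₂ lam β γ).transitionKernel (N + 1) T T t)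
        ((pinnedChain ω₂ lam β γ).gibbsMeasure (N + 1) T)) →
      ∀ (F : PhaseSpace (N + 1) → ℝ) (ϑ C : ℝ), 0 < ϑ → ϑ < 1 / T → Continuous F →
        (∀ x, |F x| ≤ C * Real.exp (ϑ * (pinnedChain ω₂ lam β γ).hamiltonian (N + 1) x)) →
        (∀ x, IntegrableOn (fun t : ℝ => (∫ y, (y.2 (Fin.last N)) ^ 2
              ∂((pinnedChain ω₂ lam β γ).transitionKernel (N + 1) T T t.toNNReal x)) - T)
            (Set.Ioi 0) ∧
          F x = ∫ t in Set.Ioi (0 : ℝ), ((∫ y, (y.2 (Fin.last N)) ^ 2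
              ∂((pinnedChain ω₂ lam β γ).transitionKernel (N + 1) T T t.toNNReal x)) - T)) →
        IntegrableOn (kuboIntegrand ω₂ lam β γ T N) (Set.Ioi 0) ∧
        Integrable (fun x : PhaseSpace (N + 1) => ((x.2 0) ^ 2 - T) * F x)
          ((pinnedChain ω₂ lam β γ).gibbsMeasure (N + 1) T) ∧
        ∫ x, ((x.2 0) ^ 2 - T) * F x ∂((pinnedChain ω₂ lam β γ).gibbsMeasure (N + 1) T) =
          ∫ t in Set.Ioi (0 : ℝ), kuboIntegrand ω₂ lam β γ T N t := by
  sorry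

/-- **stub 4 — `stub_extendedStationarity` (STATIONARITY BEYOND `C_c^∞`; size M).**
For `ν` as in stub 1 (probability, kernel-invariant at `(a,b)`, all exponential moments `ϑ' < 1/max(a,b)`) and
every `F ∈ C²` with `|F|, |∂_{q_i}F|, |∂_{p_i}F|, |∂²_{p_i}F| ≤ C e^{ϑH}`, `0 < ϑ < 1/max(a,b)`:
`L_{a,b}F ∈ L¹(ν)` and `∫ L_{a,b} F dν = 0`. This is the ONLY place the dynamics of the PERTURBED state
enters (Disproof `limitClause_false_without_steady`: stationarity is load-bearing — here it is used, and used
beyond compact support).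
Why true: `|L_{a,b}F| ≤ poly(x)·C e^{ϑH} ≤ C' e^{ϑ'H}`, `ϑ < ϑ' < 1/max(a,b)`; weak stationarity
`∫ L f dν = 0` holds for `f ∈ C_c^∞` (`LangevinChainSemigroup.IsInvariant.integral_generator_eq_zero`, Dynkin
`pinnedChain_dynkin`), extends to `C²_c` by mollification (`L f_ε → L f` uniformly), then to `F` through the
smooth energy cutoffs `F·χ(H/R)` of `LangevinChainExpBound.lean`: `L(Fχ_R) = χ_R LF + F Lχ_R + 2γ Σ_b T_b ∂_{p_b}F ∂_{p_b}χ_R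
→ LF` dominated by `C'e^{ϑ'H}`.
Why it might fail: routine (the mollification step needs `C²`, which stub 2 supplies; more regularity of `F`
would only make it easier).
Sources: CuneoEckmannHairerReyBellet2018 §3 (3.4); card poisson-transfer First lemma `ExtendedStationarity`;
TRIAGE-r1-3 (shared prerequisite "extended stationarity/Dynkin for e^{θH}-weighted C² observables under μ⋆_δ"). -/
theorem stub_extendedStationarity :
    ∀ ω₂ lam β γ : ℝ, 0 < ω₂ → 0 < lam → 0 < β → 0 < γ →
    ∀ (N : ℕ) (a b : ℝ), 0 < a → 0 < b →
    ∀ ν : Measure (PhaseSpace (N + 1)), IsProbabilityMeasure ν →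
      (∀ t, ProbabilityTheory.Kernel.Invariant
        ((pinnedChain ω₂ lam β γ).transitionKernel (N + 1) a b t) ν) →
      (∀ ϑ : ℝ, 0 < ϑ → ϑ < 1 / max a b →
        Integrable (fun x => Real.exp (ϑ * (pinnedChain ω₂ lam β γ).hamiltonian (N + 1) x)) ν) →
      ∀ (F : PhaseSpace (N + 1) → ℝ) (ϑ C : ℝ), 0 < ϑ → ϑ < 1 / max a b → ContDiff ℝ 2 F →
        (∀ x, |F x| ≤ C * Real.exp (ϑ * (pinnedChain ω₂ lam β γ).hamiltonian (N + 1) x)) →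
        (∀ i x, |partialQ i F x| ≤
          C * Real.exp (ϑ * (pinnedChain ω₂ lam β γ).hamiltonian (N + 1) x)) →
        (∀ i x, |partialP i F x| ≤
          C * Real.exp (ϑ * (pinnedChain ω₂ lam β γ).hamiltonian (N + 1) x)) →
        (∀ i x, |partialP i (partialP i F) x| ≤
          C * Real.exp (ϑ * (pinnedChain ω₂ lam β γ).hamiltonian (N + 1) x)) →
        Integrable ((pinnedChain ω₂ lam β γ).generator (N + 1) a b F) ν ∧
          ∫ x, (pinnedChain ω₂ lam β γ).generator (N + 1) a b F x ∂ν = 0 := by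
  sorry

/-- **stub 5 — `stub_uniformExpMoments` (= the panel's `LocallyUniformH2`; size M).**
Exponential moments of the invariant probability measures are bounded LOCALLY UNIFORMLY in the bath
temperatures: for `0 < ϑ < 1/T` there are `r > 0` and `M` such that every kernel-invariant probability measure
`ν` at `(a,b)` with `|a-T|, |b-T| < r` and `e^{ϑH} ∈ L¹(ν)` has `∫ e^{ϑH} dν ≤ M`.
Why true: H2 (`CuneoEckmannHairerReyBellet2018_H2_holds`, CEHR Thm 5.1/Rem 5.2) gives
`∫ e^{ϑH} dν = ∫ K_1 e^{ϑH} dν ≤ κ ∫ e^{ϑH} dν + c`, so `∫ e^{ϑH}dν ≤ c/(1-κ)`; the constants of the tree's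
proof (`LangevinChainH2Proof`, `LangevinChainTheorem51`: dissipation scale `K = H^{1/4}`, (3.4) with rate
`ϑγ(T_L+T_R)`) depend on `(a,b)` only through `max(a,b)` and continuous expressions, hence can be chosen
uniformly for `(a,b)` near `(T,T)` with `ϑ < 1/(T+r)` (choose `r` first). As TYPED in the tree H2 is
existential in `(κ,c,K)` per parameter point, so this is a re-threading of that proof, not an instantiation
(TRIAGE-r1-2: "bookkeeping, but not one line"; recommended to be filed FIRST whatever line is picked — it is
shared by all nine cards).
Why it might fail: it does not, short of an error in the tree's H2 proof; the only risk is size.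
Sources: CuneoEckmannHairerReyBellet2018 Thm 5.1, Rem 5.2, (3.4)–(3.6); tree `LangevinChainH2Proof.lean`,
`LangevinChainDynkin.lean` (`CuneoEckmannHairerReyBellet2018_H2`); TRIAGE-r1-1 sharpen, r1-2 LEANS-ON, r1-3 map (U). -/
theorem stub_uniformExpMoments :
    ∀ ω₂ lam β γ : ℝ, 0 < ω₂ → 0 < lam → 0 < β → 0 < γ → ∀ (N : ℕ) (T : ℝ), 0 < T →
      ∀ ϑ : ℝ, 0 < ϑ → ϑ < 1 / T →
        ∃ r M : ℝ, 0 < r ∧ ∀ a b : ℝ, |a - T| < r → |b - T| < r →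
          ∀ ν : Measure (PhaseSpace (N + 1)), IsProbabilityMeasure ν →
            (∀ t, ProbabilityTheory.Kernel.Invariant
              ((pinnedChain ω₂ lam β γ).transitionKernel (N + 1) a b t) ν) →
            Integrable (fun x => Real.exp (ϑ * (pinnedChain ω₂ lam β γ).hamiltonian (N + 1) x)) ν →
            ∫ x, Real.exp (ϑ * (pinnedChain ω₂ lam β γ).hamiltonian (N + 1) x) ∂ν ≤ M := by
  sorry

/-- **stub 6 — `stub_nessContinuity` (CONTINUITY OF THE STEADY STATE AT EQUILIBRIUM, weighted-weak; size M+).**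
Under weak-NESS uniqueness, for a steady family `μ` whose exponential moments are bounded near `(T,T)`
(the output of stub 5 via `family_spec`), `(a,b) ↦ ∫ Ψ d(μ (N+1) a b)` is continuous AT `(T,T)` with value
`∫ Ψ dμ₀` (Gibbs), for every continuous `Ψ = O(e^{ϑH})`, `ϑ < 1/T`. No rate, no spectral gap, no
`δ`-derivative: compactness + the crux's own hypothesis.
Why true: `e^{ϑ''H}`-moments bounded uniformly (`ϑ < ϑ'' < 1/T`) and compact sublevel sets of `H`
(`pinnedChain_isCompact_setOf_exp_le`) give tightness; along any sequence `(a_n,b_n) → (T,T)` a weak limit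
point `ν'` is a probability measure with `∫ L_{T,T} f dν' = lim ∫ L_{a_n,b_n} f dμ_n = 0` for `f ∈ C_c^∞`
(`generator_affine`: the coefficients are affine in `(a,b)`, `L_{a_n,b_n}f → L_{T,T}f` uniformly) and
integrable currents (Fatou), i.e. a weak steady state at `(T,T)`, hence `ν' = μ₀`
(`pinnedChain_isSteadyState_gibbsMeasure` + uniqueness); uniform integrability upgrades weak convergence to
`O(e^{ϑH})` observables; at the point itself `μ (N+1) T T = μ₀` (`steadyFamily_apply_self`).
Why it might fail: it does not mathematically; Lean cost is Prokhorov/tightness on `ℝ^{2(N+1)}` (Mathlib: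
`MeasureTheory.ProbabilityMeasure`, `isTightMeasureSet` API) — size driver.
Sources: card poisson-transfer (iii); HairerMajda2010 Rem. 2.4 (continuity vs differentiability of
invariant measures); TRIAGE-r1-1 sharpen ("NessContinuity also needs H2's (κ,c) locally uniform in δ" — supplied
as the hypothesis below), r1-3 map. -/
theorem stub_nessContinuity :
    ∀ ω₂ lam β γ : ℝ, 0 < ω₂ → 0 < lam → 0 < β → 0 < γ →
      (∀ (M : ℕ) (T_L T_R : ℝ), 0 < T_L → 0 < T_R → ∀ μ' ν' : Measure (PhaseSpace M),
        (pinnedChain ω₂ lam β γ).IsSteadyState M T_L T_R μ' →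
          (pinnedChain ω₂ lam β γ).IsSteadyState M T_L T_R ν' → μ' = ν') →
      ∀ μ : (M : ℕ) → ℝ → ℝ → Measure (PhaseSpace M),
        (∀ (M : ℕ) (T_L T_R : ℝ), 0 < T_L → 0 < T_R →
          (pinnedChain ω₂ lam β γ).IsSteadyState M T_L T_R (μ M T_L T_R)) →
      ∀ (N : ℕ) (T : ℝ), 0 < T →
        (∀ ϑ : ℝ, 0 < ϑ → ϑ < 1 / T → ∃ r M : ℝ, 0 < r ∧ ∀ a b : ℝ, |a - T| < r → |b - T| < r →
          Integrable (fun x => Real.exp (ϑ * (pinnedChain ω₂ lam β γ).hamiltonian (N + 1) x))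
              (μ (N + 1) a b) ∧
            ∫ x, Real.exp (ϑ * (pinnedChain ω₂ lam β γ).hamiltonian (N + 1) x) ∂(μ (N + 1) a b) ≤ M) →
        ∀ (ϑ C : ℝ), 0 < ϑ → ϑ < 1 / T → ∀ Ψ : PhaseSpace (N + 1) → ℝ, Continuous Ψ →
          (∀ x, |Ψ x| ≤ C * Real.exp (ϑ * (pinnedChain ω₂ lam β γ).hamiltonian (N + 1) x)) →
          Tendsto (fun ab : ℝ × ℝ => ∫ x, Ψ x ∂(μ (N + 1) ab.1 ab.2)) (𝓝 (T, T))
            (𝓝 (∫ x, Ψ x ∂((pinnedChain ω₂ lam β γ).gibbsMeasure (N + 1) T))) := by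
  sorry

/-- **stub 7 — `stub_gibbsPairing` (THE TWO GIBBS PAIRINGS: GAUSSIAN IBP AND THE BATH SUM RULE; size M).**
For `F ∈ C²` with `|F|, |∂_{p_i}F|, |∂²_{p_i}F| ≤ Ce^{ϑH}` (`ϑ < 1/T`) solving `L_{T,T}F = -(p_N² - T)`:
(i) `T² μ₀(∂²_{p_0}F) = μ₀((p_0² - T)F)` — Gaussian integration by parts twice in `p_0` under the explicit
density `e^{-H/T}` (tree: `integral_bath_mul_gibbsDensity` for `C²_c`, extended by the energy cutoffs);
(ii) the SUM RULE `γ(μ₀(∂²_{p_0}F) + μ₀(∂²_{p_N}F)) = 1` — the total response of `μ(p_N²)` to a UNIFORM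
shift of both bath temperatures is `1`. Recommended proof of (ii), needing NO dynamics and NO detailed balance:
along the equal-temperature family the steady state is EXPLICIT, `μ_{T+ε,T+ε} = Gibbs_{T+ε}`; Gibbs
stationarity extended to weighted `C²` (`integral_generator_mul_gibbsDensity` + cutoffs) and
`generator_affine` give `0 = ∫ L_{T+ε,T+ε}F dGibbs_{T+ε} = -(⟨p_N²⟩_{T+ε} - T) + γε·s(ε)`,
`s(ε) = ∫(∂²_{p_0}F + ∂²_{p_N}F) dGibbs_{T+ε}`; equipartition `⟨p_N²⟩_{T+ε} = T + ε` forces `s(ε) = 1/γ`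
for small `ε ≠ 0`, and `s` is continuous at `0` (dominated convergence under `e^{-H/(T+ε)}`), so
`s(0) = 1/γ`. (Alternative: `L₀H = γ(2T - p_0² - p_N²)` + `Θ`-detailed balance, the card's derivation; the
sum rule was verified EXACTLY in the Gaussian closure: TRIAGE C2 `2γ(W₀₀+W_NN) = 1`, 9/9 and 6/6 points.)
`N = 0`: (ii) reads `2γ μ₀(∂²_{p_0}F) = 1` (one site, friction `2γ`), consistent.
Why it might fail: it does not (exact identity, refuter-checked); cost = cutoff bookkeeping under Gibbs.
Sources: CuneoEckmannHairerReyBellet2018 §3.1 (proof of Prop. 3.3); tree `LangevinChainGibbs.lean`;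
KunduDharNarayan2009 (reln3, bond-to-bath sum rule); TRIAGE-r1-1 C2, r1-2 A1, r1-3 ep_check; Disproof §2. -/
theorem stub_gibbsPairing :
    ∀ ω₂ lam β γ : ℝ, 0 < ω₂ → 0 < lam → 0 < β → 0 < γ → ∀ (N : ℕ) (T : ℝ), 0 < T →
      ∀ (F : PhaseSpace (N + 1) → ℝ) (ϑ C : ℝ), 0 < ϑ → ϑ < 1 / T → ContDiff ℝ 2 F →
        (∀ x, |F x| ≤ C * Real.exp (ϑ * (pinnedChain ω₂ lam β γ).hamiltonian (N + 1) x)) →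
        (∀ i x, |partialP i F x| ≤
          C * Real.exp (ϑ * (pinnedChain ω₂ lam β γ).hamiltonian (N + 1) x)) →
        (∀ i x, |partialP i (partialP i F) x| ≤
          C * Real.exp (ϑ * (pinnedChain ω₂ lam β γ).hamiltonian (N + 1) x)) →
        (∀ x, (pinnedChain ω₂ lam β γ).generator (N + 1) T T F x =
          -((x.2 (Fin.last N)) ^ 2 - T)) →
        Integrable (fun x => partialP 0 (partialP 0 F) x)
            ((pinnedChain ω₂ lam β γ).gibbsMeasure (N + 1) T) ∧
          Integrable (fun x => partialP (Fin.last N) (partialP (Fin.last N) F) x)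
            ((pinnedChain ω₂ lam β γ).gibbsMeasure (N + 1) T) ∧
          T ^ 2 * ∫ x, partialP 0 (partialP 0 F) x ∂((pinnedChain ω₂ lam β γ).gibbsMeasure (N + 1) T) =
            ∫ x, ((x.2 0) ^ 2 - T) * F x ∂((pinnedChain ω₂ lam β γ).gibbsMeasure (N + 1) T) ∧
          γ * ((∫ x, partialP 0 (partialP 0 F) x ∂((pinnedChain ω₂ lam β γ).gibbsMeasure (N + 1) T)) +
              ∫ x, partialP (Fin.last N) (partialP (Fin.last N) F) x
                ∂((pinnedChain ω₂ lam β γ).gibbsMeasure (N + 1) T)) = 1 := by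
  sorry


/-! ## § 3 The composition (kernel-checked, no `sorry` outside the stubs) -/

/-- **The composition of the line.** From the seven stubs: both conjuncts of the crux body at one parameter
point, one steady family, one `T > 0`, one `N`. Dependency order: `family_spec` (uniqueness ⇒ invariance class)
→ stub 2 (Poisson solution `F`, Gibbs invariance from `family_spec` + `steadyFamily_apply_self`) → stub 3
(integrability clause + `μ₀((p_0²-T)F) = ∫C_N`) → stub 7 (Gibbs pairings) → [for `|δ| < δ₁`] stub 1 (energy
balance) + stub 4 (extended stationarity) + `generator_affine` ⇒ `totalCurrent μ_δ = δ·Nγ((γ/2)μ_δ(W) + ½)`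
→ stub 5 ⇒ hypothesis of stub 6 ⇒ continuity of `δ ↦ μ_δ(W)` at `0` → limit along `𝓝[≠] 0` and the value
algebra `Nγ((γ/2)(A - B) + ½) = N(γ²/T²)∫C_N` from `T²A = ∫C_N`, `γ(A+B) = 1`. -/
theorem boundaryKubo_of_stubs {ω₂ lam β γ : ℝ} (hω : 0 < ω₂) (hl : 0 < lam) (hβ : 0 < β)
    (hγ : 0 < γ) (hU : UniqueSteady ω₂ lam β γ) {μ : (M : ℕ) → ℝ → ℝ → Measure (PhaseSpace M)}
    (hμ : SteadyFamily ω₂ lam β γ μ) {T : ℝ} (hT : 0 < T) (N : ℕ) :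
    IntegrableOn (kuboIntegrand ω₂ lam β γ T N) (Ioi 0) ∧ LimitClause ω₂ lam β γ μ T N := by
  -- § G0: the family at positive temperatures is the Harris invariant measure; Gibbs at `(T,T)`
  have hfam := fun (a b : ℝ) (ha : 0 < a) (hb : 0 < b) => family_spec hω hl hβ hγ hU hμ N ha hb
  have hGibbs : μ (N + 1) T T = (pinnedChain ω₂ lam β γ).gibbsMeasure (N + 1) T :=
    steadyFamily_apply_self hω hl hβ hU hμ hT (N + 1)
  have hinv0 : ∀ t, Kernel.Invariant ((pinnedChain ω₂ lam β γ).transitionKernel (N + 1) T T t)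
      ((pinnedChain ω₂ lam β γ).gibbsMeasure (N + 1) T) := by
    rw [← hGibbs]
    exact (hfam T T hT hT).2.1
  -- § G1: the Poisson solution (stub 2), the Green–Kubo pairing (stub 3), the Gibbs pairings (stub 7)
  obtain ⟨F, ϑ, C, hϑ0, hϑ1, hF2, hF0, hFq, hFp, hFpp, hPDE, hrep⟩ :=
    stub_poissonSolution ω₂ lam β γ hω hl hβ hγ N T hT hinv0
  obtain ⟨hKint, -, hPK⟩ := stub_greenKuboPairing ω₂ lam β γ hω hl hβ hγ N T hT hinv0 F ϑ C hϑ0 hϑ1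
    hF2.continuous hF0 hrep
  refine ⟨hKint, ?_⟩
  obtain ⟨hAint, hBint, hTA, hsum⟩ :=
    stub_gibbsPairing ω₂ lam β γ hω hl hβ hγ N T hT F ϑ C hϑ0 hϑ1 hF2 hF0 hFp hFpp hPDE
  -- the observable `W = ∂²_{p_0}F - ∂²_{p_N}F`
  have hPP : ∀ i, Continuous (partialP i (partialP i F)) := fun i =>
    continuous_partialP (contDiff_partialP hF2 (by norm_num) i) one_ne_zero i
  have hWc : Continuous fun x : PhaseSpace (N + 1) =>
      partialP 0 (partialP 0 F) x - partialP (Fin.last N) (partialP (Fin.last N) F) x :=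
    (hPP 0).sub (hPP (Fin.last N))
  have hWb : ∀ x : PhaseSpace (N + 1),
      |partialP 0 (partialP 0 F) x - partialP (Fin.last N) (partialP (Fin.last N) F) x| ≤
        (C + C) * Real.exp (ϑ * (pinnedChain ω₂ lam β γ).hamiltonian (N + 1) x) := by
    intro x
    have h1 := hFpp 0 x
    have h2 := hFpp (Fin.last N) x
    exact (abs_sub _ _).trans (by linarith)
  -- § G2: locally uniform exponential moments of the family (stub 5 + family_spec)
  have hmom : ∀ ϑ' : ℝ, 0 < ϑ' → ϑ' < 1 / T → ∃ r M : ℝ, 0 < r ∧ ∀ a b : ℝ, |a - T| < r →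
      |b - T| < r →
      Integrable (fun x => Real.exp (ϑ' * (pinnedChain ω₂ lam β γ).hamiltonian (N + 1) x))
          (μ (N + 1) a b) ∧
        ∫ x, Real.exp (ϑ' * (pinnedChain ω₂ lam β γ).hamiltonian (N + 1) x) ∂(μ (N + 1) a b) ≤ M := by
    intro ϑ' h0 h1
    obtain ⟨r, M, hr, hM⟩ := stub_uniformExpMoments ω₂ lam β γ hω hl hβ hγ N T hT ϑ' h0 h1
    have hTϑ : T * ϑ' < 1 := by rwa [lt_div_iff₀ hT, mul_comm] at h1
    have hgap : T < 1 / ϑ' := by rw [lt_div_iff₀ h0]; exact hTϑ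
    set r' : ℝ := min r (min (T / 2) ((1 / ϑ' - T) / 2)) with hr'
    have hr'pos : 0 < r' := lt_min hr (lt_min (by positivity) (by linarith))
    refine ⟨r', M, hr'pos, fun a b ha hb => ?_⟩
    have har : |a - T| < r := lt_of_lt_of_le ha (min_le_left _ _)
    have hbr : |b - T| < r := lt_of_lt_of_le hb (min_le_left _ _)
    have ha2 : |a - T| < T / 2 := lt_of_lt_of_le ha ((min_le_right _ _).trans (min_le_left _ _))
    have hb2 : |b - T| < T / 2 := lt_of_lt_of_le hb ((min_le_right _ _).trans (min_le_left _ _))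
    have ha3 : |a - T| < (1 / ϑ' - T) / 2 :=
      lt_of_lt_of_le ha ((min_le_right _ _).trans (min_le_right _ _))
    have hb3 : |b - T| < (1 / ϑ' - T) / 2 :=
      lt_of_lt_of_le hb ((min_le_right _ _).trans (min_le_right _ _))
    have hapos : 0 < a := by have := (abs_lt.mp ha2).1; linarith
    have hbpos : 0 < b := by have := (abs_lt.mp hb2).1; linarith
    have hmax : ϑ' < 1 / max a b := by
      have ha' : a < 1 / ϑ' := by have := (abs_lt.mp ha3).2; linarith
      have hb' : b < 1 / ϑ' := by have := (abs_lt.mp hb3).2; linarith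
      have hm : max a b < 1 / ϑ' := max_lt ha' hb'
      rw [lt_div_iff₀ h0] at hm
      rw [lt_div_iff₀ (lt_max_of_lt_left hapos), mul_comm]
      exact hm
    obtain ⟨hprob, hinv, hint⟩ := hfam a b hapos hbpos
    have hI := hint ϑ' h0 hmax
    exact ⟨hI, hM a b har hbr _ hprob hinv hI⟩
  -- § G3: continuity of `δ ↦ μ_δ(W)` at `0` (stub 6)
  have hcont := stub_nessContinuity ω₂ lam β γ hω hl hβ hγ hU μ hμ N T hT hmom ϑ (C + C) hϑ0 hϑ1
    _ hWc hWb
  have hpath : Tendsto (fun δ : ℝ => (T + δ / 2, T - δ / 2)) (𝓝 0) (𝓝 (T, T)) :=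
    (by fun_prop : Continuous fun δ : ℝ => (T + δ / 2, T - δ / 2)).tendsto' 0 (T, T) (by simp)
  have hw : Tendsto (fun δ : ℝ => ∫ x, (partialP 0 (partialP 0 F) x -
      partialP (Fin.last N) (partialP (Fin.last N) F) x) ∂(μ (N + 1) (T + δ / 2) (T - δ / 2)))
      (𝓝 0) (𝓝 (∫ x, (partialP 0 (partialP 0 F) x -
        partialP (Fin.last N) (partialP (Fin.last N) F) x)
          ∂((pinnedChain ω₂ lam β γ).gibbsMeasure (N + 1) T))) :=
    hcont.comp hpath
  -- § G4: the exact finite-δ identity on the window `|δ| < δ₁`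
  have hTϑ : T * ϑ < 1 := by rwa [lt_div_iff₀ hT, mul_comm] at hϑ1
  have hgapT : T < 1 / ϑ := by rw [lt_div_iff₀ hϑ0]; exact hTϑ
  set δ₁ : ℝ := min T (1 / ϑ - T) with hδ₁
  have hδ₁pos : 0 < δ₁ := lt_min hT (by linarith)
  have key : ∀ δ : ℝ, |δ| < δ₁ →
      (pinnedChain ω₂ lam β γ).totalCurrent (μ (N + 1) (T + δ / 2) (T - δ / 2)) =
        δ * (N * γ * (γ / 2 * ∫ x, (partialP 0 (partialP 0 F) x -
          partialP (Fin.last N) (partialP (Fin.last N) F) x) ∂(μ (N + 1) (T + δ / 2) (T - δ / 2)) +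
            1 / 2)) := by
    intro δ hδ
    have hδT : |δ| < T := lt_of_lt_of_le hδ (min_le_left _ _)
    have hδg : |δ| < 1 / ϑ - T := lt_of_lt_of_le hδ (min_le_right _ _)
    obtain ⟨hδl, hδr⟩ := abs_lt.mp hδT
    obtain ⟨hδl', hδr'⟩ := abs_lt.mp hδg
    have ha : 0 < T + δ / 2 := by linarith
    have hb : 0 < T - δ / 2 := by linarith
    have hmax : ϑ < 1 / max (T + δ / 2) (T - δ / 2) := by
      have hm : max (T + δ / 2) (T - δ / 2) < 1 / ϑ := max_lt (by linarith) (by linarith)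
      rw [lt_div_iff₀ hϑ0] at hm
      rw [lt_div_iff₀ (lt_max_of_lt_left ha), mul_comm]
      exact hm
    obtain ⟨hprob, hinv, hint⟩ := hfam _ _ ha hb
    -- stub 1 and stub 4 for `ν = μ_δ`
    obtain ⟨hp2, hJ⟩ := stub_energyBalance ω₂ lam β γ hω hl hβ hγ N _ _ ha hb _ hprob hinv hint
    obtain ⟨hLint, hL0⟩ := stub_extendedStationarity ω₂ lam β γ hω hl hβ hγ N _ _ ha hb _ hprob hinv
      hint F ϑ C hϑ0 hmax hF2 hF0 hFq hFp hFpp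
    -- pointwise: `L_δ F = -(p_N² - T) + (γδ/2)·W` (affine generator + Poisson equation)
    have hptw : ∀ x, (pinnedChain ω₂ lam β γ).generator (N + 1) (T + δ / 2) (T - δ / 2) F x =
        -((x.2 (Fin.last N)) ^ 2 - T) + γ * δ / 2 * (partialP 0 (partialP 0 F) x -
          partialP (Fin.last N) (partialP (Fin.last N) F) x) := by
      intro x
      rw [generator_affine (pinnedChain ω₂ lam β γ) N (T + δ / 2) (T - δ / 2) T F x, hPDE x]
      have hγP : (pinnedChain ω₂ lam β γ).γ = γ := rfl
      rw [hγP]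
      ring
    -- integrate against `μ_δ`
    have hgInt : Integrable (fun x : PhaseSpace (N + 1) => -((x.2 (Fin.last N)) ^ 2 - T))
        (μ (N + 1) (T + δ / 2) (T - δ / 2)) :=
      (hp2.sub (integrable_const T)).neg
    have hWint : Integrable (fun x : PhaseSpace (N + 1) => γ * δ / 2 * (partialP 0 (partialP 0 F) x -
        partialP (Fin.last N) (partialP (Fin.last N) F) x)) (μ (N + 1) (T + δ / 2) (T - δ / 2)) := by
      have heq : (fun x : PhaseSpace (N + 1) => γ * δ / 2 * (partialP 0 (partialP 0 F) x -
          partialP (Fin.last N) (partialP (Fin.last N) F) x)) = fun x =>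
          (pinnedChain ω₂ lam β γ).generator (N + 1) (T + δ / 2) (T - δ / 2) F x -
            (-((x.2 (Fin.last N)) ^ 2 - T)) := by
        funext x
        rw [hptw x]
        ring
      rw [heq]
      exact hLint.sub hgInt
    have hI : ∫ x, (pinnedChain ω₂ lam β γ).generator (N + 1) (T + δ / 2) (T - δ / 2) F x
        ∂(μ (N + 1) (T + δ / 2) (T - δ / 2)) =
        -((∫ x, (x.2 (Fin.last N)) ^ 2 ∂(μ (N + 1) (T + δ / 2) (T - δ / 2))) - T) +
          γ * δ / 2 * ∫ x, (partialP 0 (partialP 0 F) x -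
            partialP (Fin.last N) (partialP (Fin.last N) F) x) ∂(μ (N + 1) (T + δ / 2) (T - δ / 2)) := by
      simp_rw [hptw]
      rw [integral_add hgInt hWint, integral_neg, integral_sub hp2 (integrable_const T), integral_const,
        integral_const_mul, smul_eq_mul, probReal_univ, one_mul]
    rw [hI] at hL0
    rw [hJ]
    linear_combination (-(N : ℝ) * γ) * hL0
  -- § G5: the limit along `𝓝[≠] 0` and its value
  have hev : (fun δ : ℝ => N * γ * (γ / 2 * ∫ x, (partialP 0 (partialP 0 F) x -
      partialP (Fin.last N) (partialP (Fin.last N) F) x) ∂(μ (N + 1) (T + δ / 2) (T - δ / 2)) + 1 / 2))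
      =ᶠ[𝓝[≠] (0 : ℝ)]
      fun δ => (pinnedChain ω₂ lam β γ).totalCurrent (μ (N + 1) (T + δ / 2) (T - δ / 2)) / δ := by
    have hball : Ioo (-δ₁) δ₁ ∈ 𝓝 (0 : ℝ) := Ioo_mem_nhds (by linarith) hδ₁pos
    filter_upwards [mem_nhdsWithin_of_mem_nhds hball, self_mem_nhdsWithin] with δ hδ hne
    rw [key δ (abs_lt.mpr ⟨hδ.1, hδ.2⟩), mul_div_cancel_left₀ _ (Set.mem_compl_singleton_iff.mp hne)]
  have hlim : Tendsto (fun δ : ℝ => N * γ * (γ / 2 * ∫ x, (partialP 0 (partialP 0 F) x -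
      partialP (Fin.last N) (partialP (Fin.last N) F) x) ∂(μ (N + 1) (T + δ / 2) (T - δ / 2)) + 1 / 2))
      (𝓝[≠] 0) (𝓝 (N * γ * (γ / 2 * (∫ x, (partialP 0 (partialP 0 F) x -
        partialP (Fin.last N) (partialP (Fin.last N) F) x)
          ∂((pinnedChain ω₂ lam β γ).gibbsMeasure (N + 1) T)) + 1 / 2))) :=
    (tendsto_const_nhds.mul ((tendsto_const_nhds.mul hw).add tendsto_const_nhds)).mono_left
      nhdsWithin_le_nhds
  have hval : N * γ * (γ / 2 * (∫ x, (partialP 0 (partialP 0 F) x -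
      partialP (Fin.last N) (partialP (Fin.last N) F) x)
        ∂((pinnedChain ω₂ lam β γ).gibbsMeasure (N + 1) T)) + 1 / 2) = kuboValue ω₂ lam β γ T N := by
    rw [integral_sub hAint hBint]
    unfold kuboValue
    rw [← hPK, ← hTA]
    have hT0 : T ≠ 0 := hT.ne'
    set A := ∫ x, partialP 0 (partialP 0 F) x ∂((pinnedChain ω₂ lam β γ).gibbsMeasure (N + 1) T)
      with hA
    set B := ∫ x, partialP (Fin.last N) (partialP (Fin.last N) F) x
      ∂((pinnedChain ω₂ lam β γ).gibbsMeasure (N + 1) T) with hB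
    rw [show (1 : ℝ) / 2 = γ * (A + B) / 2 by rw [hsum]]
    field_simp
    ring
  unfold LimitClause
  rw [← hval]
  exact hlim.congr' hev

/-- **`BoundaryKubo_of` — the line concludes the crux BY NAME.** `BoundaryKubo` (the route decl,
`Summit.AtomisticToContinuum.FouriersLaw.Theses.PhononMeanFreePath.BoundaryKubo`) from the seven stubs
`stub_energyBalance`, `stub_poissonSolution`, `stub_greenKuboPairing`, `stub_extendedStationarity`,
`stub_uniformExpMoments`, `stub_nessContinuity`, `stub_gibbsPairing` through `boundaryKubo_of_stubs`; the
read-back `boundaryKubo_iff` is `Iff.rfl`. -/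
theorem BoundaryKubo_of : BoundaryKubo :=
  boundaryKubo_iff.mpr fun _ _ _ _ hω hl hβ hγ hU _ hμ _ hT N =>
    boundaryKubo_of_stubs hω hl hβ hγ hU hμ hT N

end Summit.AtomisticToContinuum.FouriersLaw.Cruxes.BoundaryKubo.PoissonTransfer

end
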